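import Literature.MathematicalPhysics.QuantumManyBody.PeriodicBoseGasEq228
import HarnessLib

/-!
# Fournais 2020, (2.29) in first quantisation, I: the pairing `⟨b_p†Φ, b_{-p}Φ⟩` on the `n`-sector

Topic `Literature/MathematicalPhysics/QuantumManyBody` (provefact
`Literature.MathematicalPhysics.QuantumManyBody.BoseGas.Fournais2020_condensation`, layer
`Fournais2020_eq229`). The pairing identity [Fournais2020, (2.29)],
"`A₂ = ½(2π)⁻³∫Ŵ₁(k)(b_k†b_{-k}† + b_kb_{-k})dk`", is proved in this topic for bounded states
(`Fournais2020_eq229_bdd`, `PeriodicBoseGasBounded.lean`) in three steps: (I) the momentum-space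
integrand `⟨b_p†Φ, b_{-p}Φ⟩` is written as a first-quantised matrix element; (II) against the
Fourier transform of a nice (continuous, integrable, with integrable transform) even potential the
momentum integral is computed by Fourier inversion and Fubini; (III) the potential `W₁ ∈ L¹` is
mollified and the limit is taken on both sides. This file is step (I) and the bounds needed for the
dominated convergence in (III):

* `integral_conj_bDagVec_mul_bVec` — for `Φ ∈ L²(Λ(u)ⁿ⁺¹)`,
  `⟨b_p†Φ, b_{-p}Φ⟩ = ∑_{i≠j}∫_{Λⁿ⁺¹} conj(PᵢPⱼΦ) conj(φ_p(xᵢ))φ_p(xⱼ) QⱼQᵢΦ dX`, `φ_p = χ_Λe^{2πi⟨·,p⟩}`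
  (from `b_p† = ∑ᵢ(Qφ_p)(xᵢ)Pᵢ`, `b_{-p} = ∑ⱼPⱼφ_p(xⱼ)Qⱼ` (`bVec_neg_eq_sum`), `Pᵢ = Pᵢ*`, `Qᵢ = Qᵢ*`,
  `[Pᵢ, Mⱼ] = 0` for `i ≠ j`, `PᵢPⱼ = PⱼPᵢ` and `QᵢQⱼ = QⱼQᵢ` a.e.; the diagonal vanishes because
  `∫_Λ Qφ_p = 0`);
* `lintegral_normSq_bDagVec_le`, `lintegral_normSq_bVec_le_nPlus` — `sup_p‖b_p†Φ‖² ≤ (2(n+1)sup|χ|)²‖Φ‖²`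
  and `‖b_pΦ‖² ≤ (n+1)sup|χ|²⟨Φ,n₊Φ⟩`;
* `enorm_integral_conj_mul_le` (Cauchy–Schwarz) and `measurable_pairingRe` (joint measurability of
  `(p, X) ↦ (b_p†Φ)(X)`, `(b_{-p}Φ)(X)`).

No new definitions.

## References

* [Fournais2020] S. Fournais, *Length scales for BEC in the dilute Bose gas*, arXiv:2011.00309,
  EMS Ser. Congr. Rep. 18 (2021), doi:10.4171/ecr/18-1/7: (2.5), (2.27)–(2.29), (3.5).
* [FournaisSolovej2020] S. Fournais, J. P. Solovej, *The energy of dilute Bose gases*,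
  Ann. of Math. 192 (2020) 893–976: §6 (the operators `b_k`).
-/

noncomputable section

open MeasureTheory Set
open scoped ENNReal NNReal FourierTransform ComplexConjugate RealInnerProductSpace

namespace Literature.MathematicalPhysics.QuantumManyBody.BoseGas

/-! ### One-body facts: `∫_Λ Qφ = 0`, the wave `φ_p` off the box -/

section OneBody

variable {χ : Space → ℝ} {ℓ : ℝ} {u : Space}

/-- **`Q_u` kills the constants**: `∫_{Λ(u)} Q_uφ = 0` for `φ` integrable on the box
(`Q = 1 - ℓ⁻³|1⟩⟨1|`, `|Λ| = ℓ³`). [cite: Fournais2020, (2.5), (3.5)] -/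
theorem setIntegral_projQ_eq_zero (hℓ : 0 < ℓ) (u : Space) {φ : Space → ℂ}
    (hφ : IntegrableOn φ (slidingBox ℓ u) volume) :
    ∫ y in slidingBox ℓ u, projQ ℓ u φ y = 0 := by
  have hA := measurableSet_slidingBox ℓ u
  haveI : IsFiniteMeasure ((volume : Measure Space).restrict (slidingBox ℓ u)) :=
    isFiniteMeasure_restrict_slidingBox ℓ u
  set c : ℂ := ((ℓ ^ 3)⁻¹ : ℝ) • ∫ y in slidingBox ℓ u, φ y with hc
  have h1 : EqOn (projQ ℓ u φ) (fun y => φ y - c) (slidingBox ℓ u) := fun y hy => by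
    simp only [projQ, indicator_of_mem hy, hc]
  rw [setIntegral_congr_fun hA h1, integral_sub hφ (integrable_const c), setIntegral_const,
    measureReal_def, volume_slidingBox, hc, Complex.real_smul, Complex.real_smul, ← ENNReal.ofReal_pow hℓ.le,
    ENNReal.toReal_ofReal (by positivity), ← mul_assoc, ← Complex.ofReal_mul,
    mul_inv_cancel₀ (by positivity), Complex.ofReal_one, one_mul, sub_self]

/-- `φ_p` vanishes off the box (as `χ_Λ` does). [cite: Fournais2020, (2.27)] -/
theorem locWave_eq_zero_of_not_mem (hχ : IsLocalizationFunction χ) (hℓ : 0 < ℓ) (p : Space) {y : Space}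
    (hy : y ∉ slidingBox ℓ u) : locWave χ ℓ u p y = 0 := by
  rw [locWave, locFun_eq_zero_of_not_mem hχ hℓ hy, Complex.ofReal_zero, zero_mul]

/-- `|φ_p| ≤ sup|χ|`. [cite: Fournais2020, (2.27)] -/
theorem norm_locWave_le {Cχ : ℝ} (hCχ : ∀ x, ‖χ x‖ ≤ Cχ) (ℓ : ℝ) (u p y : Space) :
    ‖locWave χ ℓ u p y‖ ≤ Cχ := by
  rw [norm_locWave, ← Real.norm_eq_abs]
  exact hCχ _

/-- `conj(φ_p(x)) φ_p(y) = χ_Λ(x)χ_Λ(y) e^{2πi⟨y - x, p⟩}`. [cite: Fournais2020, (2.27)] -/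
theorem conj_locWave_mul_locWave (χ : Space → ℝ) (ℓ : ℝ) (u p x y : Space) :
    conj (locWave χ ℓ u p x) * locWave χ ℓ u p y =
      ((locFun χ ℓ u x * locFun χ ℓ u y : ℝ) : ℂ) * (𝐞 (⟪y - x, p⟫) : ℂ) := by
  rw [conj_locWave, locWave, inner_sub_left, sub_eq_add_neg, AddChar.map_add_eq_mul, Circle.coe_mul,
    Complex.ofReal_mul]
  ring

end OneBody

/-! ### `n`-body algebra: `Qᵢ` as a multiplier-commuting, self-adjoint projection; `b_{-p}Φ` through `QⱼΦ` -/

section NBody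

variable {m : ℕ} {χ : Space → ℝ} {ℓ : ℝ} {u : Space}

/-- `Λ(u)ⁿ` is measurable. [folklore] -/
theorem measurableSet_boxConfig (n : ℕ) (ℓ : ℝ) (u : Space) : MeasurableSet (boxConfig n ℓ u) := by
  rw [boxConfig_eq_pi]
  exact MeasurableSet.univ_pi fun _ => measurableSet_slidingBox ℓ u

/-- `Qᵢ` is homogeneous for factors not depending on `xᵢ`: `Qᵢ(HG) = H·QᵢG`. [cite: Fournais2020, (2.5)] -/
theorem nbodyQ_mul_left (ℓ : ℝ) (u : Space) (i : Fin (m + 1)) {H : Config (m + 1) → ℂ}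
    (hH : ∀ X y, H (Function.update X i y) = H X) (G : Config (m + 1) → ℂ) (X : Config (m + 1)) :
    nbodyQ ℓ u i (fun Y => H Y * G Y) X = H X * nbodyQ ℓ u i G X := by
  rw [nbodyQ, nbodyQ, nbodyP_mul_left ℓ u i hH G X, mul_sub]

/-- `Pᵢ` of a function of `xᵢ` alone is its box average: `Pᵢ[φ(xᵢ)](X) = ℓ⁻³∫_Λ φ`. [cite: Fournais2020, (2.5)] -/
theorem nbodyP_comp_eval (ℓ : ℝ) (u : Space) (i : Fin (m + 1)) (φ : Space → ℂ) (X : Config (m + 1)) :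
    nbodyP ℓ u i (fun Y => φ (Y i)) X = ((ℓ ^ 3)⁻¹ : ℝ) • ∫ y in slidingBox ℓ u, φ y := by
  simp only [nbodyP, Function.update_self]

/-- **`Qᵢ` is self-adjoint on `L²(Λⁿ⁺¹)`**: `⟨QᵢF, G⟩ = ⟨F, QᵢG⟩`. [cite: Fournais2020, (2.5)] -/
theorem integral_conj_nbodyQ_mul (hℓ : 0 < ℓ) (i : Fin (m + 1)) {F G : Config (m + 1) → ℂ}
    (hFm : Measurable F) (hF : MemLp F 2 (volume.restrict (boxConfig (m + 1) ℓ u)))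
    (hGm : Measurable G) (hG : MemLp G 2 (volume.restrict (boxConfig (m + 1) ℓ u))) :
    ∫ X in boxConfig (m + 1) ℓ u, conj (nbodyQ ℓ u i F X) * G X =
      ∫ X in boxConfig (m + 1) ℓ u, conj (F X) * nbodyQ ℓ u i G X := by
  have hPF := memLp_nbodyP hℓ i hFm hF
  have hPG := memLp_nbodyP hℓ i hGm hG
  have h1 : ∀ X, conj (nbodyQ ℓ u i F X) * G X = conj (F X) * G X - conj (nbodyP ℓ u i F X) * G X := fun X => by
    rw [nbodyQ, map_sub, sub_mul]
  have h2 : ∀ X, conj (F X) * nbodyQ ℓ u i G X = conj (F X) * G X - conj (F X) * nbodyP ℓ u i G X := fun X => by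
    rw [nbodyQ, mul_sub]
  simp only [h1, h2]
  rw [integral_sub (integrable_conj_mul hF hG) (integrable_conj_mul hPF hG),
    integral_sub (integrable_conj_mul hF hG) (integrable_conj_mul hF hPG),
    integral_conj_nbodyP_mul hℓ i hFm hF hGm hG]

/-- **`Qᵢ` and `Qⱼ` commute a.e.** on `L¹(Λⁿ⁺¹)` (as `Pᵢ`, `Pⱼ` do). [cite: Fournais2020, (2.5)] -/
theorem nbodyQ_comm_ae (hℓ : 0 < ℓ) {i j : Fin (m + 1)} (hij : i ≠ j) {F : Config (m + 1) → ℂ}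
    (hFm : Measurable F) (hF : Integrable F (volume.restrict (boxConfig (m + 1) ℓ u))) :
    ∀ᵐ X ∂volume.restrict (boxConfig (m + 1) ℓ u),
      nbodyQ ℓ u i (nbodyQ ℓ u j F) X = nbodyQ ℓ u j (nbodyQ ℓ u i F) X := by
  filter_upwards [nbodyP_comm_ae hij hFm hF, nbodyP_sub_ae i hF (integrable_nbodyP hℓ j hFm hF),
    nbodyP_sub_ae j hF (integrable_nbodyP hℓ i hFm hF)] with X h1 h2 h3
  rw [nbodyQ, nbodyQ, show nbodyQ ℓ u j F = fun Y => F Y - nbodyP ℓ u j F Y from rfl, h2, nbodyQ,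
    show nbodyQ ℓ u i F = fun Y => F Y - nbodyP ℓ u i F Y from rfl, h3, h1]
  ring

/-- **`b_{-p}Φ` through the excited slices**: for every `X`,
`(b_{-p}Φ)(X) = ∑ⱼ Pⱼ[φ_p(xⱼ)·QⱼΦ](X) = ℓ⁻³∑ⱼ∫_Λ φ_p(y)(QⱼΦ)(X; xⱼ = y)dy`
(`b_{-k} = ℓ⁻³a†(θ)a(Qχ_Λe^{ikx}) = ℓ⁻³∑ⱼ|1⟩⟨conj φ_p|ⱼQⱼ`; pointwise, no integrability needed). [cite: Fournais2020, (2.27)] -/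
theorem bVec_neg_eq_sum (hχ : IsLocalizationFunction χ) (hℓ : 0 < ℓ) (u p : Space) (Φ : Config (m + 1) → ℂ)
    (X : Config (m + 1)) :
    bVec χ ℓ u (-p) Φ X =
      ∑ j : Fin (m + 1), nbodyP ℓ u j (fun Y => locWave χ ℓ u p (Y j) * nbodyQ ℓ u j Φ Y) X := by
  have h1 : ∀ j : Fin (m + 1), excAmp χ ℓ u j Φ X (-p) =
      ∫ y in slidingBox ℓ u, locWave χ ℓ u p y * nbodyQ ℓ u j Φ (Function.update X j y) := by
    intro j
    rw [excAmp, Real.fourier_eq]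
    have h2 : ∀ y : Space, (𝐞 (-⟪y, -p⟫) : Circle) • sliceExc χ ℓ u j Φ X y =
        locWave χ ℓ u p y * nbodyQ ℓ u j Φ (Function.update X j y) := by
      intro y
      by_cases hy : y ∈ slidingBox ℓ u
      · rw [sliceExc, projQ_slice_eq_nbodyQ ℓ u j Φ X hy, Circle.smul_def, smul_eq_mul, inner_neg_right, neg_neg,
          locWave]
        ring
      · rw [sliceExc, locWave_eq_zero_of_not_mem hχ hℓ p hy, locFun_eq_zero_of_not_mem hχ hℓ hy]
        simp
    simp_rw [h2]
    refine (setIntegral_eq_integral_of_forall_compl_eq_zero fun y hy => ?_).symm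
    rw [locWave_eq_zero_of_not_mem hχ hℓ p hy, zero_mul]
  rw [bVec, Finset.smul_sum]
  refine Finset.sum_congr rfl fun j _ => ?_
  rw [h1 j, nbodyP]
  simp only [Function.update_self]

/-- **The pairing expectation in first quantisation.** For `Φ ∈ L²(Λ(u)ⁿ⁺¹)` and every momentum `p`,
`⟨b_p†Φ, b_{-p}Φ⟩ = ∑_{i ≠ j} ∫_{Λⁿ⁺¹} conj(PᵢPⱼΦ)(X) · conj(φ_p(xᵢ))φ_p(xⱼ) · (QⱼQᵢΦ)(X) dX`,
`φ_p = χ_Λe^{2πi⟨·,p⟩}`: the `n`-sector matrix element of `b_pb_{-p} = ℓ⁻⁶∑_{i≠j}Qᵢ|φ_p⟩ᵢ⟨1|ᵢ · |1⟩ⱼ⟨conj φ_p|ⱼQⱼ`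
(the diagonal `i = j` vanishes as `⟨1|Q = 0`; `Pᵢ = Pᵢ*`, `Qᵢ = Qᵢ*`, operators on different
particles commute). This is the integrand of (2.29) before the momentum integral. [cite: Fournais2020, (2.27), (2.29)] -/
theorem integral_conj_bDagVec_mul_bVec (hχ : IsLocalizationFunction χ) (hℓ : 0 < ℓ) (u p : Space)
    {Φ : Config (m + 1) → ℂ} (hΦm : Measurable Φ) (hΦ2 : MemLp Φ 2 (volume.restrict (boxConfig (m + 1) ℓ u))) :
    ∫ X in boxConfig (m + 1) ℓ u, conj (bDagVec χ ℓ u p Φ X) * bVec χ ℓ u (-p) Φ X =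
      ∑ i : Fin (m + 1), ∑ j : Fin (m + 1) with j ≠ i, ∫ X in boxConfig (m + 1) ℓ u,
        conj (nbodyP ℓ u i (nbodyP ℓ u j Φ) X) * (conj (locWave χ ℓ u p (X i)) * locWave χ ℓ u p (X j)) *
          nbodyQ ℓ u j (nbodyQ ℓ u i Φ) X := by
  have hB := measurableSet_boxConfig (m + 1) ℓ u
  obtain ⟨Cχ, hCχ⟩ := hχ.exists_bound
  -- the one-body players
  set φ : Space → ℂ := locWave χ ℓ u p with hφ
  set q : Space → ℂ := projQ ℓ u φ with hq
  have hφc : Continuous φ := continuous_locWave hχ.continuous ℓ u p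
  have hφm : Measurable φ := hφc.measurable
  have hφb : ∀ y, ‖φ y‖ ≤ Cχ := fun y => norm_locWave_le hCχ ℓ u p y
  have hqm : Measurable q := measurable_projQ_locWave hχ.continuous ℓ u p
  obtain ⟨Cq, hCq⟩ := exists_bound_projQ_locWave hχ ℓ u p
  set cφ : ℂ := ((ℓ ^ 3)⁻¹ : ℝ) • ∫ y in slidingBox ℓ u, φ y with hcφ
  have hqφ : ∀ y ∈ slidingBox ℓ u, q y = φ y - cφ := fun y hy => by
    simp only [hq, projQ, indicator_of_mem hy, hcφ]
  have hq0 : ∫ y in slidingBox ℓ u, q y = 0 :=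
    setIntegral_projQ_eq_zero hℓ u (integrableOn_slidingBox hφc ℓ u)
  -- `L²` bookkeeping
  have hΦi : Integrable Φ (volume.restrict (boxConfig (m + 1) ℓ u)) := integrable_of_memLp_two hΦ2
  have hP : ∀ i, MemLp (nbodyP ℓ u i Φ) 2 (volume.restrict (boxConfig (m + 1) ℓ u)) := fun i =>
    memLp_nbodyP hℓ i hΦm hΦ2
  have hPm : ∀ i, Measurable (nbodyP ℓ u i Φ) := fun i => measurable_nbodyP ℓ u i hΦm
  have hQ : ∀ i, MemLp (nbodyQ ℓ u i Φ) 2 (volume.restrict (boxConfig (m + 1) ℓ u)) := fun i =>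
    memLp_nbodyQ hℓ i hΦm hΦ2
  have hQm : ∀ i, Measurable (nbodyQ ℓ u i Φ) := fun i => measurable_nbodyQ ℓ u i hΦm
  -- `Fᵢ = q(xᵢ)PᵢΦ` (the summands of `b_p†Φ`) and `Gⱼ = φ(xⱼ)QⱼΦ`
  set F : Fin (m + 1) → Config (m + 1) → ℂ := fun i X => q (X i) * nbodyP ℓ u i Φ X with hF
  set G : Fin (m + 1) → Config (m + 1) → ℂ := fun j Y => φ (Y j) * nbodyQ ℓ u j Φ Y with hG
  have hFm : ∀ i, Measurable (F i) := fun i => (measurable_comp_eval hqm i).mul (hPm i)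
  have hF2 : ∀ i, MemLp (F i) 2 (volume.restrict (boxConfig (m + 1) ℓ u)) := fun i => memLp_mul hqm hCq i (hP i)
  have hGm : ∀ j, Measurable (G j) := fun j => (measurable_comp_eval hφm j).mul (hQm j)
  have hG2 : ∀ j, MemLp (G j) 2 (volume.restrict (boxConfig (m + 1) ℓ u)) := fun j => memLp_mul hφm hφb j (hQ j)
  have hPG2 : ∀ j, MemLp (nbodyP ℓ u j (G j)) 2 (volume.restrict (boxConfig (m + 1) ℓ u)) := fun j =>
    memLp_nbodyP hℓ j (hGm j) (hG2 j)
  -- expand `⟨∑ᵢFᵢ, ∑ⱼPⱼGⱼ⟩`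
  have hdag : ∀ X, bDagVec χ ℓ u p Φ X = ∑ i, F i X := fun X => rfl
  have hexp : ∫ X in boxConfig (m + 1) ℓ u, conj (bDagVec χ ℓ u p Φ X) * bVec χ ℓ u (-p) Φ X =
      ∑ i, ∑ j, ∫ X in boxConfig (m + 1) ℓ u, conj (F i X) * nbodyP ℓ u j (G j) X := by
    have h1 : ∀ X, conj (bDagVec χ ℓ u p Φ X) * bVec χ ℓ u (-p) Φ X =
        ∑ i, ∑ j, conj (F i X) * nbodyP ℓ u j (G j) X := fun X => by
      rw [hdag, bVec_neg_eq_sum hχ hℓ u p Φ X, map_sum, Finset.sum_mul_sum]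
    simp_rw [h1]
    have hint : ∀ i j, Integrable (fun X => conj (F i X) * nbodyP ℓ u j (G j) X)
        (volume.restrict (boxConfig (m + 1) ℓ u)) := fun i j => integrable_conj_mul (hF2 i) (hPG2 j)
    rw [integral_finsetSum _ fun i _ => integrable_finsetSum _ fun j _ => hint i j]
    exact Finset.sum_congr rfl fun i _ => integral_finsetSum _ fun j _ => hint i j
  rw [hexp]
  refine Finset.sum_congr rfl fun i _ => ?_
  -- split off the diagonal
  rw [← Finset.sum_filter_add_sum_filter_not Finset.univ (fun j => j ≠ i)]
  have hdiag_set : (Finset.univ.filter fun j : Fin (m + 1) => ¬j ≠ i) = {i} := by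
    ext j; simp
  rw [hdiag_set, Finset.sum_singleton]
  -- the diagonal vanishes: `⟨q(xᵢ)PᵢΦ, PᵢGᵢ⟩ = ⟨Pᵢ[q(xᵢ)PᵢΦ], Gᵢ⟩` and `Pᵢ[q(xᵢ)PᵢΦ] = PᵢΦ·ℓ⁻³∫_Λq = 0`
  have hdiag : ∫ X in boxConfig (m + 1) ℓ u, conj (F i X) * nbodyP ℓ u i (G i) X = 0 := by
    rw [← integral_conj_nbodyP_mul hℓ i (hFm i) (hF2 i) (hGm i) (hG2 i)]
    have h0 : ∀ X, nbodyP ℓ u i (F i) X = 0 := fun X => by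
      have h1 : F i = fun Y => nbodyP ℓ u i Φ Y * q (Y i) := by funext Y; simp only [hF, mul_comm]
      rw [h1, nbodyP_mul_left ℓ u i (H := nbodyP ℓ u i Φ) (fun X y => nbodyP_update ℓ u i Φ X y),
        nbodyP_comp_eval, hq0, smul_zero, mul_zero]
    simp only [h0, map_zero, zero_mul, integral_zero]
  rw [hdiag, add_zero]
  refine Finset.sum_congr rfl fun j hj => ?_
  have hji : j ≠ i := (Finset.mem_filter.1 hj).2
  have hij : i ≠ j := hji.symm
  -- `K = PⱼPᵢΦ` (independent of `xᵢ` and `xⱼ`)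
  set K : Config (m + 1) → ℂ := nbodyP ℓ u j (nbodyP ℓ u i Φ) with hK
  have hKm : Measurable K := measurable_nbodyP ℓ u j (hPm i)
  have hK2 : MemLp K 2 (volume.restrict (boxConfig (m + 1) ℓ u)) := memLp_nbodyP hℓ j (hPm i) (hP i)
  have hKi : ∀ X y, K (Function.update X i y) = K X := fun X y => nbodyP_nbodyP_update_right ℓ u hji Φ X y
  -- Step 1: `⟨Fᵢ, PⱼGⱼ⟩ = ⟨PⱼFᵢ, Gⱼ⟩` and `PⱼFᵢ = q(xᵢ)K`
  rw [← integral_conj_nbodyP_mul hℓ j (hFm i) (hF2 i) (hGm j) (hG2 j)]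
  have hPF : ∀ X, nbodyP ℓ u j (F i) X = q (X i) * K X := fun X =>
    nbodyP_mul_left ℓ u j (H := fun Y => q (Y i)) (fun X y => by simp only [Function.update_of_ne hij]) _ X
  simp only [hPF]
  -- Step 2: on `Λⁿ⁺¹`, `q(xᵢ)K = Qᵢ[φ(xᵢ)K]`
  have hQφK : ∀ X ∈ boxConfig (m + 1) ℓ u, q (X i) * K X = nbodyQ ℓ u i (fun Y => φ (Y i) * K Y) X := by
    intro X hX
    have h1 : (fun Y => φ (Y i) * K Y) = fun Y => K Y * φ (Y i) := by funext Y; ring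
    rw [h1, nbodyQ_mul_left ℓ u i hKi, nbodyQ, nbodyP_comp_eval, hqφ _ (hX i), ← hcφ]
    ring
  rw [setIntegral_congr_fun hB (fun X hX => by rw [hQφK X hX])]
  -- Step 3: `⟨Qᵢ[φ(xᵢ)K], Gⱼ⟩ = ⟨φ(xᵢ)K, QᵢGⱼ⟩` and `QᵢGⱼ = φ(xⱼ)QᵢQⱼΦ`
  have hφKm : Measurable fun Y => φ (Y i) * K Y := (measurable_comp_eval hφm i).mul hKm
  have hφK2 : MemLp (fun Y => φ (Y i) * K Y) 2 (volume.restrict (boxConfig (m + 1) ℓ u)) := memLp_mul hφm hφb i hK2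
  rw [integral_conj_nbodyQ_mul hℓ i hφKm hφK2 (hGm j) (hG2 j)]
  have hQG : ∀ X, nbodyQ ℓ u i (G j) X = φ (X j) * nbodyQ ℓ u i (nbodyQ ℓ u j Φ) X := fun X =>
    nbodyQ_mul_left ℓ u i (H := fun Y => φ (Y j)) (fun X y => by simp only [Function.update_of_ne hji]) _ X
  simp only [hQG]
  -- Step 4: commute `PⱼPᵢ = PᵢPⱼ` and `QᵢQⱼ = QⱼQᵢ` a.e., and rearrange
  refine integral_congr_ae ?_
  filter_upwards [nbodyP_comm_ae hij hΦm hΦi, nbodyQ_comm_ae hℓ hij hΦm hΦi] with X h1 h2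
  rw [hK, ← h1, h2, map_mul]
  ring

end NBody

/-! ### Uniform bounds in the momentum and measurability of the pairing -/

section Bounds

variable {m : ℕ} {χ : Space → ℝ} {ℓ : ℝ} {u : Space}

/-- **`‖Qφ_p‖_∞ ≤ 2 sup|χ|`** uniformly in `p` (`|φ_p| ≤ sup|χ|`, `|ℓ⁻³∫_Λφ_p| ≤ sup|χ|`). [cite: Fournais2020, (2.27)] -/
theorem norm_projQ_locWave_le {Cχ : ℝ} (hCχ : ∀ x, ‖χ x‖ ≤ Cχ) (hℓ : 0 < ℓ) (u p y : Space) :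
    ‖projQ ℓ u (locWave χ ℓ u p) y‖ ≤ 2 * Cχ := by
  have hC0 : 0 ≤ Cχ := (norm_nonneg _).trans (hCχ 0)
  refine (norm_projQ_le_of_bound ℓ u (fun z => norm_locWave_le hCχ ℓ u p z) y).trans ?_
  have h1 : ‖∫ z in slidingBox ℓ u, locWave χ ℓ u p z‖ ≤ Cχ * ℓ ^ 3 := by
    refine (norm_setIntegral_le_of_norm_le_const (by rw [volume_slidingBox]; exact ENNReal.pow_lt_top ENNReal.ofReal_lt_top)
      fun z _ => norm_locWave_le hCχ ℓ u p z).trans_eq ?_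
    rw [measureReal_def, volume_slidingBox, ← ENNReal.ofReal_pow hℓ.le, ENNReal.toReal_ofReal (by positivity)]
  rw [norm_smul, Real.norm_eq_abs, abs_of_pos (by positivity)]
  calc Cχ + (ℓ ^ 3)⁻¹ * ‖∫ z in slidingBox ℓ u, locWave χ ℓ u p z‖ ≤ Cχ + (ℓ ^ 3)⁻¹ * (Cχ * ℓ ^ 3) := by
        gcongr
    _ = 2 * Cχ := by field_simp; ring

/-- `(‖ab‖₊)² = ...`: the square of an `ℝ≥0∞`-norm of a product with a bounded factor. [folklore] -/
theorem ennnorm_mul_sq_le {a b : ℂ} {C : ℝ} (ha : ‖a‖ ≤ C) :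
    ((‖a * b‖₊ : ℝ≥0∞)) ^ 2 ≤ ENNReal.ofReal (C ^ 2) * ((‖b‖₊ : ℝ≥0∞)) ^ 2 := by
  have hC : 0 ≤ C := (norm_nonneg _).trans ha
  rw [coe_nnnorm_sq_eq_ofReal, coe_nnnorm_sq_eq_ofReal, ← ENNReal.ofReal_mul (sq_nonneg _), norm_mul, mul_pow]
  exact ENNReal.ofReal_le_ofReal (mul_le_mul_of_nonneg_right (pow_le_pow_left₀ (norm_nonneg _) ha 2) (sq_nonneg _))

/-- **`sup_p ‖b_p†Φ‖ < ∞`**: `‖b_p†Φ‖² ≤ (2(n+1) sup|χ|)² ‖Φ‖²` on `L²(Λⁿ⁺¹)`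
(`‖∑ᵢq(xᵢ)PᵢΦ‖ ≤ ∑ᵢ‖q‖_∞‖PᵢΦ‖ ≤ (n+1)·2sup|χ|·‖Φ‖`). [cite: Fournais2020, (2.27)–(2.28)] -/
theorem lintegral_normSq_bDagVec_le {Cχ : ℝ} (hCχ : ∀ x, ‖χ x‖ ≤ Cχ) (hℓ : 0 < ℓ)
    (u p : Space) {Φ : Config (m + 1) → ℂ} (hΦm : Measurable Φ) :
    ∫⁻ X in boxConfig (m + 1) ℓ u, ((‖bDagVec χ ℓ u p Φ X‖₊ : ℝ≥0∞)) ^ 2 ≤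
      ENNReal.ofReal (((m + 1 : ℕ) : ℝ) * (2 * Cχ) ^ 2) * (m + 1 : ℕ) *
        ∫⁻ X in boxConfig (m + 1) ℓ u, ((‖Φ X‖₊ : ℝ≥0∞)) ^ 2 := by
  set q : Space → ℂ := projQ ℓ u (locWave χ ℓ u p) with hq
  have hqb : ∀ y, ‖q y‖ ≤ 2 * Cχ := fun y => norm_projQ_locWave_le hCχ hℓ u p y
  have hPm : ∀ i, Measurable (nbodyP ℓ u i Φ) := fun i => measurable_nbodyP ℓ u i hΦm
  -- pointwise: `‖∑ᵢ q(xᵢ)PᵢΦ‖² ≤ (n+1)∑ᵢ(2Cχ)²‖PᵢΦ‖²`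
  have hpt : ∀ X, ((‖bDagVec χ ℓ u p Φ X‖₊ : ℝ≥0∞)) ^ 2 ≤
      ENNReal.ofReal (((m + 1 : ℕ) : ℝ) * (2 * Cχ) ^ 2) * ∑ i, ((‖nbodyP ℓ u i Φ X‖₊ : ℝ≥0∞)) ^ 2 := by
    intro X
    have h1 := norm_sum_sq_le (Finset.univ : Finset (Fin (m + 1))) fun i => q (X i) * nbodyP ℓ u i Φ X
    simp only [Finset.card_univ, Fintype.card_fin] at h1
    have h2 : ∀ i, ‖q (X i) * nbodyP ℓ u i Φ X‖ ^ 2 ≤ (2 * Cχ) ^ 2 * ‖nbodyP ℓ u i Φ X‖ ^ 2 := fun i => by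
      rw [norm_mul, mul_pow]
      exact mul_le_mul_of_nonneg_right (pow_le_pow_left₀ (norm_nonneg _) (hqb _) 2) (sq_nonneg _)
    have h3 : ‖bDagVec χ ℓ u p Φ X‖ ^ 2 ≤ ((m + 1 : ℕ) : ℝ) * (2 * Cχ) ^ 2 * ∑ i, ‖nbodyP ℓ u i Φ X‖ ^ 2 := by
      calc ‖bDagVec χ ℓ u p Φ X‖ ^ 2 = ‖∑ i, q (X i) * nbodyP ℓ u i Φ X‖ ^ 2 := rfl
        _ ≤ ((m + 1 : ℕ) : ℝ) * ∑ i, ‖q (X i) * nbodyP ℓ u i Φ X‖ ^ 2 := h1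
        _ ≤ ((m + 1 : ℕ) : ℝ) * ∑ i, (2 * Cχ) ^ 2 * ‖nbodyP ℓ u i Φ X‖ ^ 2 := by
            gcongr with i; exact h2 i
        _ = _ := by rw [← Finset.mul_sum]; ring
    calc ((‖bDagVec χ ℓ u p Φ X‖₊ : ℝ≥0∞)) ^ 2 = ENNReal.ofReal (‖bDagVec χ ℓ u p Φ X‖ ^ 2) := coe_nnnorm_sq_eq_ofReal _
      _ ≤ ENNReal.ofReal (((m + 1 : ℕ) : ℝ) * (2 * Cχ) ^ 2 * ∑ i, ‖nbodyP ℓ u i Φ X‖ ^ 2) := ENNReal.ofReal_le_ofReal h3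
      _ = _ := by
          rw [ENNReal.ofReal_mul (by positivity), ENNReal.ofReal_sum_of_nonneg (fun i _ => sq_nonneg _)]
          congr 1
          exact Finset.sum_congr rfl fun i _ => (coe_nnnorm_sq_eq_ofReal _).symm
  calc ∫⁻ X in boxConfig (m + 1) ℓ u, ((‖bDagVec χ ℓ u p Φ X‖₊ : ℝ≥0∞)) ^ 2
      ≤ ∫⁻ X in boxConfig (m + 1) ℓ u, ENNReal.ofReal (((m + 1 : ℕ) : ℝ) * (2 * Cχ) ^ 2) *
          ∑ i, ((‖nbodyP ℓ u i Φ X‖₊ : ℝ≥0∞)) ^ 2 := lintegral_mono hpt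
    _ = ENNReal.ofReal (((m + 1 : ℕ) : ℝ) * (2 * Cχ) ^ 2) *
          ∑ i, ∫⁻ X in boxConfig (m + 1) ℓ u, ((‖nbodyP ℓ u i Φ X‖₊ : ℝ≥0∞)) ^ 2 := by
        rw [lintegral_const_mul _ (Finset.measurable_sum _ fun i _ => (hPm i).nnnorm.coe_nnreal_ennreal.pow_const _),
          lintegral_finsetSum' _ fun i _ => ((hPm i).nnnorm.coe_nnreal_ennreal.pow_const _).aemeasurable]
    _ ≤ ENNReal.ofReal (((m + 1 : ℕ) : ℝ) * (2 * Cχ) ^ 2) *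
          ∑ _i : Fin (m + 1), ∫⁻ X in boxConfig (m + 1) ℓ u, ((‖Φ X‖₊ : ℝ≥0∞)) ^ 2 :=
        mul_le_mul_right (Finset.sum_le_sum fun i _ => lintegral_nbodyP_sq_le hℓ i hΦm) _
    _ = _ := by rw [Finset.sum_const, Finset.card_univ, Fintype.card_fin, nsmul_eq_mul, mul_assoc]

/-- **`‖b_pΦ‖² ≤ (n+1) sup|χ|² ⟨Φ, n₊Φ⟩`** for every `p` (`b_pΦ = ∑ⱼPⱼ[φ_{-p}(xⱼ)QⱼΦ]`, `Pⱼ` a contraction).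
[cite: Fournais2020, (2.27), (2.32)] -/
theorem lintegral_normSq_bVec_le_nPlus (hχ : IsLocalizationFunction χ) {Cχ : ℝ} (hCχ : ∀ x, ‖χ x‖ ≤ Cχ) (hℓ : 0 < ℓ)
    (u p : Space) {Φ : Config (m + 1) → ℂ} (hΦm : Measurable Φ) :
    ∫⁻ X in boxConfig (m + 1) ℓ u, ((‖bVec χ ℓ u p Φ X‖₊ : ℝ≥0∞)) ^ 2 ≤
      ENNReal.ofReal (((m + 1 : ℕ) : ℝ) * Cχ ^ 2) * nPlusBoxN ℓ u Φ := by
  set φ : Space → ℂ := locWave χ ℓ u (-p) with hφ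
  have hφm : Measurable φ := (continuous_locWave hχ.continuous ℓ u (-p)).measurable
  have hφb : ∀ y, ‖φ y‖ ≤ Cχ := fun y => norm_locWave_le hCχ ℓ u (-p) y
  have hQm : ∀ j, Measurable (nbodyQ ℓ u j Φ) := fun j => measurable_nbodyQ ℓ u j hΦm
  set G : Fin (m + 1) → Config (m + 1) → ℂ := fun j Y => φ (Y j) * nbodyQ ℓ u j Φ Y with hG
  have hGm : ∀ j, Measurable (G j) := fun j => (measurable_comp_eval hφm j).mul (hQm j)
  have hPGm : ∀ j, Measurable (nbodyP ℓ u j (G j)) := fun j => measurable_nbodyP ℓ u j (hGm j)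
  have hpt : ∀ X, ((‖bVec χ ℓ u p Φ X‖₊ : ℝ≥0∞)) ^ 2 ≤
      ((m + 1 : ℕ) : ℝ≥0∞) * ∑ j, ((‖nbodyP ℓ u j (G j) X‖₊ : ℝ≥0∞)) ^ 2 := by
    intro X
    have h0 : bVec χ ℓ u p Φ X = ∑ j, nbodyP ℓ u j (G j) X := by
      have h := bVec_neg_eq_sum hχ hℓ u (-p) Φ X
      rwa [neg_neg] at h
    have h1 := norm_sum_sq_le (Finset.univ : Finset (Fin (m + 1))) fun j => nbodyP ℓ u j (G j) X
    simp only [Finset.card_univ, Fintype.card_fin] at h1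
    calc ((‖bVec χ ℓ u p Φ X‖₊ : ℝ≥0∞)) ^ 2 = ENNReal.ofReal (‖∑ j, nbodyP ℓ u j (G j) X‖ ^ 2) := by
          rw [coe_nnnorm_sq_eq_ofReal, h0]
      _ ≤ ENNReal.ofReal (((m + 1 : ℕ) : ℝ) * ∑ j, ‖nbodyP ℓ u j (G j) X‖ ^ 2) := ENNReal.ofReal_le_ofReal h1
      _ = _ := by
          rw [ENNReal.ofReal_mul (by positivity), ENNReal.ofReal_natCast,
            ENNReal.ofReal_sum_of_nonneg (fun i _ => sq_nonneg _)]
          congr 1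
          exact Finset.sum_congr rfl fun i _ => (coe_nnnorm_sq_eq_ofReal _).symm
  calc ∫⁻ X in boxConfig (m + 1) ℓ u, ((‖bVec χ ℓ u p Φ X‖₊ : ℝ≥0∞)) ^ 2
      ≤ ∫⁻ X in boxConfig (m + 1) ℓ u, ((m + 1 : ℕ) : ℝ≥0∞) * ∑ j, ((‖nbodyP ℓ u j (G j) X‖₊ : ℝ≥0∞)) ^ 2 :=
        lintegral_mono hpt
    _ = ((m + 1 : ℕ) : ℝ≥0∞) * ∑ j, ∫⁻ X in boxConfig (m + 1) ℓ u, ((‖nbodyP ℓ u j (G j) X‖₊ : ℝ≥0∞)) ^ 2 := by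
        rw [lintegral_const_mul _ (Finset.measurable_sum _ fun j _ => (hPGm j).nnnorm.coe_nnreal_ennreal.pow_const _),
          lintegral_finsetSum' _ fun j _ => ((hPGm j).nnnorm.coe_nnreal_ennreal.pow_const _).aemeasurable]
    _ ≤ ((m + 1 : ℕ) : ℝ≥0∞) * ∑ j, ENNReal.ofReal (Cχ ^ 2) *
          ∫⁻ X in boxConfig (m + 1) ℓ u, ((‖nbodyQ ℓ u j Φ X‖₊ : ℝ≥0∞)) ^ 2 := by
        gcongr with j
        calc ∫⁻ X in boxConfig (m + 1) ℓ u, ((‖nbodyP ℓ u j (G j) X‖₊ : ℝ≥0∞)) ^ 2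
            ≤ ∫⁻ X in boxConfig (m + 1) ℓ u, ((‖G j X‖₊ : ℝ≥0∞)) ^ 2 := lintegral_nbodyP_sq_le hℓ j (hGm j)
          _ ≤ ∫⁻ X in boxConfig (m + 1) ℓ u, ENNReal.ofReal (Cχ ^ 2) * ((‖nbodyQ ℓ u j Φ X‖₊ : ℝ≥0∞)) ^ 2 :=
              lintegral_mono fun X => ennnorm_mul_sq_le (hφb _)
          _ = _ := lintegral_const_mul _ ((hQm j).nnnorm.coe_nnreal_ennreal.pow_const _)
    _ = ENNReal.ofReal (((m + 1 : ℕ) : ℝ) * Cχ ^ 2) * nPlusBoxN ℓ u Φ := by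
        rw [← Finset.mul_sum, ← mul_assoc, nPlusBoxN_eq_sum_lintegral hℓ u hΦm, ENNReal.ofReal_mul (by positivity),
          ENNReal.ofReal_natCast]

/-- **Cauchy–Schwarz** for `⟨F, G⟩ = ∫conj(F)G`: `‖⟨F,G⟩‖ₑ ≤ ‖F‖₂‖G‖₂` (as square roots of `∫⁻‖·‖₊²`). [folklore] -/
theorem enorm_integral_conj_mul_le {α : Type*} [MeasurableSpace α] (μ : Measure α) {F G : α → ℂ}
    (hF : AEMeasurable F μ) (hG : AEMeasurable G μ) :
    ‖∫ x, conj (F x) * G x ∂μ‖ₑ ≤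
      (∫⁻ x, ((‖F x‖₊ : ℝ≥0∞)) ^ 2 ∂μ) ^ (1 / 2 : ℝ) * (∫⁻ x, ((‖G x‖₊ : ℝ≥0∞)) ^ 2 ∂μ) ^ (1 / 2 : ℝ) := by
  calc ‖∫ x, conj (F x) * G x ∂μ‖ₑ ≤ ∫⁻ x, ‖conj (F x) * G x‖ₑ ∂μ := enorm_integral_le_lintegral_enorm _
    _ = ∫⁻ x, ‖F x‖ₑ * ‖G x‖ₑ ∂μ := by
        refine lintegral_congr fun x => ?_
        rw [enorm_mul, ← ofReal_norm (conj (F x)), Complex.norm_conj, ofReal_norm]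
    _ ≤ (∫⁻ x, ‖F x‖ₑ ^ (2 : ℝ) ∂μ) ^ (1 / (2 : ℝ)) * (∫⁻ x, ‖G x‖ₑ ^ (2 : ℝ) ∂μ) ^ (1 / (2 : ℝ)) :=
        ENNReal.lintegral_mul_le_Lp_mul_Lq μ Real.HolderConjugate.two_two hF.enorm hG.enorm
    _ = _ := by simp only [ENNReal.rpow_two, enorm_eq_nnnorm]

/-- `(p, y) ↦ (Qφ_p)(y)` is jointly measurable. [cite: Fournais2020, (2.27)] -/
theorem measurable_projQ_locWave₂ (hχ : IsLocalizationFunction χ) (ℓ : ℝ) (u : Space) :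
    Measurable fun r : Space × Space => projQ ℓ u (locWave χ ℓ u r.1) r.2 := by
  have hw : Continuous fun r : Space × Space => locWave χ ℓ u r.1 r.2 := by
    unfold locWave locFun
    refine ((Complex.continuous_ofReal.comp (hχ.continuous.comp ?_)).mul ?_)
    · exact (continuous_snd.sub continuous_const).const_smul (ℓ⁻¹ : ℝ)
    · exact continuous_subtype_val.comp (Real.continuous_fourierChar.comp (continuous_snd.inner continuous_fst))
  have hc : StronglyMeasurable fun p : Space => ∫ z in slidingBox ℓ u, locWave χ ℓ u p z :=
    StronglyMeasurable.integral_prod_right' (ν := volume.restrict (slidingBox ℓ u)) hw.stronglyMeasurable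
  have hS : MeasurableSet {r : Space × Space | r.2 ∈ slidingBox ℓ u} := measurable_snd (measurableSet_slidingBox ℓ u)
  have hd : Measurable fun r : Space × Space =>
      locWave χ ℓ u r.1 r.2 - ((ℓ ^ 3)⁻¹ : ℝ) • ∫ z in slidingBox ℓ u, locWave χ ℓ u r.1 z :=
    hw.measurable.sub ((hc.measurable.comp measurable_fst).const_smul ((ℓ ^ 3)⁻¹ : ℝ))
  have heq : (fun r : Space × Space => projQ ℓ u (locWave χ ℓ u r.1) r.2) =
      {r : Space × Space | r.2 ∈ slidingBox ℓ u}.indicator fun r =>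
        locWave χ ℓ u r.1 r.2 - ((ℓ ^ 3)⁻¹ : ℝ) • ∫ z in slidingBox ℓ u, locWave χ ℓ u r.1 z := by
    funext r
    by_cases hr : r.2 ∈ slidingBox ℓ u
    · have hr' : r ∈ {r : Space × Space | r.2 ∈ slidingBox ℓ u} := hr
      rw [Set.indicator_of_mem hr', projQ, Set.indicator_of_mem hr]
    · have hr' : r ∉ {r : Space × Space | r.2 ∈ slidingBox ℓ u} := hr
      rw [Set.indicator_of_notMem hr', projQ, Set.indicator_of_notMem hr]
  rw [heq]
  exact hd.indicator hS

/-- `(p, X) ↦ (b_p†Φ)(X)` is jointly measurable. [cite: Fournais2020, (2.27)] -/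
theorem measurable_bDagVec₂ (hχ : IsLocalizationFunction χ) (ℓ : ℝ) (u : Space) {Φ : Config (m + 1) → ℂ}
    (hΦm : Measurable Φ) : Measurable fun r : Space × Config (m + 1) => bDagVec χ ℓ u r.1 Φ r.2 := by
  unfold bDagVec
  refine Finset.measurable_sum _ fun i _ => ?_
  have h1 : Measurable fun r : Space × Config (m + 1) => (r.1, r.2 i) :=
    measurable_fst.prodMk ((measurable_pi_apply i).comp measurable_snd)
  exact ((measurable_projQ_locWave₂ hχ ℓ u).comp h1).mul ((measurable_nbodyP ℓ u i hΦm).comp measurable_snd)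

/-- **The pairing `p ↦ ⟨b_p†Φ, b_{-p}Φ⟩` is measurable.** [cite: Fournais2020, (2.29)] -/
theorem measurable_integral_conj_bDagVec_mul_bVec (hχ : IsLocalizationFunction χ) (ℓ : ℝ) (u : Space)
    {Φ : Config (m + 1) → ℂ} (hΦm : Measurable Φ) :
    Measurable fun p : Space => ∫ X in boxConfig (m + 1) ℓ u, conj (bDagVec χ ℓ u p Φ X) * bVec χ ℓ u (-p) Φ X := by
  have hA : Measurable fun r : Space × Config (m + 1) => conj (bDagVec χ ℓ u r.1 Φ r.2) :=
    Complex.continuous_conj.measurable.comp (measurable_bDagVec₂ hχ ℓ u hΦm)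
  have h2 : Measurable fun r : Space × Config (m + 1) => (r.2, -r.1) := measurable_snd.prodMk measurable_fst.neg
  have hB' := (measurable_bVec hχ.continuous ℓ u hΦm).comp h2
  have hB : Measurable fun r : Space × Config (m + 1) => bVec χ ℓ u (-r.1) Φ r.2 := hB'
  have h1' := (hA.mul hB).stronglyMeasurable
  have h1 : StronglyMeasurable (Function.uncurry fun (p : Space) (X : Config (m + 1)) =>
      conj (bDagVec χ ℓ u p Φ X) * bVec χ ℓ u (-p) Φ X) := h1'
  have h3 := h1.integral_prod_right (ν := volume.restrict (boxConfig (m + 1) ℓ u))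
  exact h3.measurable

/-- The pairing `Re⟨b_p†Φ, b_{-p}Φ⟩` is measurable in `p`. [cite: Fournais2020, (2.29)] -/
theorem measurable_pairingRe (hχ : IsLocalizationFunction χ) (ℓ : ℝ) (u : Space) {Φ : Config (m + 1) → ℂ}
    (hΦm : Measurable Φ) : Measurable fun p : Space => pairingRe χ ℓ u p Φ :=
  Complex.measurable_re.comp (measurable_integral_conj_bDagVec_mul_bVec hχ ℓ u hΦm)

end Bounds

end Literature.MathematicalPhysics.QuantumManyBody.BoseGas

end
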